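import Summits.BirchSwinnertonDyer.BirchSwinnertonDyer.Theorems.EdixhovenFibreFiveSevenKPResidueOfReciprocityLaw
import Summits.BirchSwinnertonDyer.BirchSwinnertonDyer.Theorems.TeichmullerTwistDescentPrincipalSeriesCells
import Summits.BirchSwinnertonDyer.BirchSwinnertonDyer.Theorems.EdixhovenFibreFiveSevenStarredOptimalManinUnitFiveSevenOfReciprocityLaw
import Summits.BirchSwinnertonDyer.BirchSwinnertonDyer.Theorems.EdixhovenFibreFiveSevenTwistDegreeStepOrdinaryOfReciprocityLaw
import Summits.BirchSwinnertonDyer.BirchSwinnertonDyer.Theorems.EdixhovenFibreFiveSevenTwistDegreeStepOrdinaryLeverAtManinUnit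
import Summits.BirchSwinnertonDyer.BirchSwinnertonDyer.Theorems.EdixhovenFibreFiveSevenMemberManinUnitFiveSevenGlue
import Summits.BirchSwinnertonDyer.BirchSwinnertonDyer.Theorems.EdixhovenFibreFiveSevenAssembly
import HarnessLib

/-!
# Manin's `p`-part at EVERY lattice-optimal datum of EVERY curve with additive potentially good reduction at `p ∈ {5, 7}`
# and `E[p]` irreducible, GRANTED ONLY {P1-bar, [REC-tower] (or hT₂), modularity} — K★ (22226), CORNER (23883), LOW (23884)
# as corollaries; no F″, no Fontaine cite, no Ihara lemma, no Kosters–Pannekoek hypothesis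

Cell `pub/bsd-wall`, seat `bsd-line-edix-p1` g19 (LEAD of line `kato_lever`, crux K★ stmt-BirchSwinnertonDyer-22226; this file
`--supports` K★ as a helper). TOOL theorems only (no definition, no named fact, no `sorry`); nothing is closed; BSD is not
proved by any of this.

WHAT. The K★ closer of the line (`…CellsOfSL2NeronValuesBar`, `…OfReciprocityLaw`: starred cells, where `W(ℚ_p)[p] = 0` is
automatic) and the Kosters–Pannekoek repair of the sequel `…KPResidueOfReciprocityLaw` (unstarred cells with a `ℚ_p`-rational
point of order `p` somewhere on the class) are the two halves of ONE statement, proved here: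

* ★★★ `not_dvd_optimal_c_fiveSeven_of_expStarTower_of_sl2NeronValuesBar` — for `W/ℚ` globally minimal, `p ∈ {5, 7}`, additive
  at `p`, `E[p]` irreducible, NO `Iₙ*` fibre at `p` (`n ≥ 0`: potentially good reduction, Kodaira II, III, IV, IV*, III*, II*),
  and `D` a LATTICE-OPTIMAL datum of `W` at any level (`Λ_W = c·Λ_f`, i.e. `W` is the `X₀(N)`-optimal curve): `p ∤ c(D)`,
  GRANTED hT₂, P1-bar and modularity. Off the KP exception on the class: the per-curve lever `not_dvd_c_of_tameTwist57_at`
  at `W` through the per-class socket `katoNeronBody_of_sl2NeronValuesBar_of_isDeRhamAt`, de Rham by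
  `DeRhamAtFiveSeven.isDeRham_adicCompletion_rat_fiveSeven`; on it: the auxiliary unit twist (`AuxPrime.transferWitness`,
  `exists_minimal_twist_pStar`, `TorsTwist.torsTwist57_input`, `LTwistTransfer.lTwist_of_transfer`) and
  `KPResidueOfReciprocityLaw.not_dvd_optimal_c_of_expStarTower_of_sl2NeronValuesBar_of_unitTwist` with `V = V₀ = W`.
  ★★★ `…_of_reciprocityLaw_…` — the same from Kato's explicit reciprocity law [REC-tower] (p700964).
* ★★★ `not_dvd_optimal_c_of_typeGOrd_member_of_expStarTower_of_sl2NeronValuesBar` — the companion at `p > 7`: `W` additive at `p`, `E[p]`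
  irreducible, SOME isogenous curve (G)-ordinary at `p`, `D` lattice-optimal at any level ⇒ `p ∤ c(D)`, GRANTED hT₂, P1-bar, modularity
  (the `p > 7` lever `not_dvd_c_of_tameTwistL_at` — no Kosters–Pannekoek exception there — through the per-class socket; de Rham by the
  tree theorem `isDeRham_restrictedRationalTateRep_adicCompletion_rat_of_typeGOrd` at the (G)-ordinary member, moved along the isogeny).
  Consumed by the TeichmullerTwistDescent Manin side (PSMU, GE11) and by AKR crux #7 (sequel files).
* By name, GRANTED {modularity, hT₂ / [REC-tower], P1-bar}: CORNER `KummerCornerTorsionOptimalManinUnit` (stmt-BirchSwinnertonDyer-23883)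
  and LOW `SupersingularTorsionOptimalManinUnitFive` (stmt-BirchSwinnertonDyer-23884) — this route's copies; `ord_p Δ_min ≤ 3 < 6`
  excludes `Iₙ*` (`TeichmullerTwistDescent.forall_ne_Istar_of_padicValInt_le_four`); their (G)-ordinary / torsion binders are
  not used — and K★ `StarredOptimalManinUnitFiveSeven` (22226) once more, as the starred sub-case.

* ★★ `wAllExclAdditiveFiveLeRankOne_of_akr_of_reciprocityLaw_of_sl2NeronValuesBar` — the RUNG `Summit.BirchSwinnertonDyer.WAllExclAdditiveFiveLeRankOne`
  (W-ALL/2.p>=5.r1) through the route's landed `EdixhovenFibreFiveSevenAssembly.assembly_proof`, GRANTED [REC-tower], P1-bar, the three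
  AKR-shared OPEN cruxes `KolyvaginPrimitiveAdditive` (21400), `RankZeroAdditive` (20133), `OffSharpRankOneAdditive` (20134) and the two
  published-input bundles `PublishedInputsAdditiveKoly` (20137), `PublishedManinFacts` (22230) — the bundle `KatoNeronAndCremonaFacts` (23789:
  F″ + Cremona's range) and the item KP57 are NO LONGER INPUTS of the rung on this road.

NET: the Manin `p`-part at `p ∈ {5, 7}` on the whole additive potentially good `E[p]`-irreducible locus of OPTIMAL curves rests on
the two print-faithful published inputs P1-bar (Kato 2004) and [REC-tower] (Kato 1993 II Thm. 1.4.1 (4)) plus modularity. The only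
additive cells at `p ∈ {5, 7}` NOT covered are the potentially multiplicative ones (`Iₙ*`, `n ≥ 1`) and `I₀*` — where the line has
no de Rham theorem (no Tate-curve period computation in the tree) — which no item of this route concerns. CONDITIONAL; items OPEN.

References: [Kato2004Asterisque] Thm. 6.6 (1), (8.1.3), Thm. 9.7; [Kato1993LNM1553] Ch. II Thm. 1.4.1 (4), Prop. 1.2.3;
[KostersPannekoek2017] Thm. 1, Cor. 2; [Stevens1989] Lemma (5.2); [EdixhovenManin1991] Thm. 3 and §4; [KrausOesterle1992] Prop. 1.
-/

set_option autoImplicit false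
-- the Theorems namespace of a single-conjunct summit repeats the summit name by design (D-0017)
set_option linter.dupNamespace false

noncomputable section

open scoped Classical MatrixGroups NumberField

open WeierstrassCurve NumberField IsDedekindDomain Field ValuativeRel
  Literature.NumberTheory.EllipticCurves Literature.NumberTheory.EllipticCurves.ModularForms
  Literature.NumberTheory.EllipticCurves.Rank1Residual Literature.NumberTheory.EllipticCurves.Kato2004
  Literature.NumberTheory.DiophantineGeometry Rat.HeightOneSpectrum
  Literature.NumberTheory.PAdicHodge Literature.NumberTheory.GaloisRepresentations
  Summit.BirchSwinnertonDyer.Rank1Residual Summit.BirchSwinnertonDyer.Rank1Residual.Additive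
  Summit.BirchSwinnertonDyer.BirchSwinnertonDyer.Theorems
  Summit.BirchSwinnertonDyer.BirchSwinnertonDyer.Theorems.KatoAssemblySocketAt
  Summit.BirchSwinnertonDyer.BirchSwinnertonDyer.Theorems.ManinFrameResidueProperRTameTwistAt
  Summit.BirchSwinnertonDyer.BirchSwinnertonDyer.Theorems.KPResidueOfReciprocityLaw
  Summit.BirchSwinnertonDyer.BirchSwinnertonDyer.Theses.EdixhovenFibreFiveSeven
  CongruenceSubgroup Complex

namespace Summit.BirchSwinnertonDyer.BirchSwinnertonDyer.Theorems.OptimalManinUnitFiveSevenOfReciprocityLaw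

variable {p : ℕ} [hp : Fact p.Prime]

/-! ### §1 The general optimal Manin unit at `p ∈ {5, 7}` -/

/-- ★★★ **Manin's `p`-part at every lattice-optimal datum of every `W/ℚ` with additive POTENTIALLY GOOD reduction at `p ∈ {5, 7}` and
`E[p]` irreducible, GRANTED hT₂, P1-bar and modularity.** `W` globally minimal, additive at `p`, `E[p]` irreducible, no `Iₙ*` fibre
at `p`, `D` a datum at any level with `Λ_W = c(D)·Λ_f`: `p ∤ c(D)`. Case `W'(ℚ_p)[p] = 0` for every minimal `W' ∼ W`: the lever
`not_dvd_c_of_tameTwist57_at` at `W` (socket `katoNeronBody_of_sl2NeronValuesBar_of_isDeRhamAt`, de Rham by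
`isDeRham_adicCompletion_rat_fiveSeven`, `a_ℓ = ±1` at `ℓ ∥ N` by `lFunction_apply_prime_eq_one_or_eq_neg_one_of_mult`); otherwise the
auxiliary unit twist and `not_dvd_optimal_c_of_expStarTower_of_sl2NeronValuesBar_of_unitTwist` at `V = V₀ = W`. CONDITIONAL on the
cite-only hT₂ / P1-bar. [cite: Kato2004Asterisque, Thm. 6.6 (1) (p. 163), (8.1.3) (p. 180), Thm. 9.7 (p. 189)]
[cite: Kato1993LNM1553, Ch. II Prop. 1.2.3 and Ex. 1.3.5] [cite: KostersPannekoek2017, Thm. 1 and Cor. 2] [cite: Stevens1989, Lemma (5.2) p. 96]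
[cite: KrausOesterle1992, Prop. 1] -/
theorem not_dvd_optimal_c_fiveSeven_of_expStarTower_of_sl2NeronValuesBar
    (hT₂ : exists_smul_range_expStarCoord_tower_iff_trace_log) (hP1 : exists_member_sl2ZetaElement_neron_values_bar)
    (hnf : exists_isNewformOf)
    (W : WeierstrassCurve ℚ) [W.IsElliptic] [W.IsGloballyMinimal] {N : ℕ} [NeZero N]
    (D : ModularParametrizationData W N) (hp57 : p = 5 ∨ p = 7) (hadd : Addv W p) (hirr : Irr W p)
    (hK : ∀ (v : HeightOneSpectrum ℤ) (n : ℕ), natGenerator v = p → W.kodairaSymbolAt v ≠ KodairaSymbol.Istar n)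
    (hopt : ∀ z ∈ D.L.lattice, ∃ w ∈ periodLattice D.f, z = D.c * w) :
    ¬ (p : ℤ) ∣ D.c := by
  have hN : N = W.conductorNorm ℤ := IsNewformOf.level_eq_conductorNorm_of_exists_isNewformOf hnf D.isNewformOf
  subst hN
  by_cases hPT : ∀ (W' : WeierstrassCurve ℚ) [W'.IsElliptic] [W'.IsGloballyMinimal], IsIsogenous W W' →
      ∀ P : (W'.baseChange ℚ_[p]).toAffine.Point, p • P = 0 → P = 0
  · -- off the Kosters–Pannekoek exception: the lever at `W` itself
    have hpN : p ^ 2 ∣ W.conductorNorm ℤ := sq_dvd_conductorNorm_of_not_good_of_not_mult hadd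
    have ha : ∀ ℓ ∈ (W.conductorNorm ℤ).primeFactors, ¬ ℓ ^ 2 ∣ W.conductorNorm ℤ →
        W.LFunction ℓ = 1 ∨ W.LFunction ℓ = -1 := by
      intro ℓ hℓ hℓ2
      haveI : Fact ℓ.Prime := ⟨Nat.prime_of_mem_primeFactors hℓ⟩
      rcases hasGoodReductionAtPrime_or_hasMultiplicativeReductionAtPrime_of_not_sq_dvd_conductorNorm (V := W) hℓ2
        with hg | hmul
      · exact absurd (Nat.dvd_of_mem_primeFactors hℓ) (not_dvd_conductorNorm_of_hasGoodReductionAtPrime W hg)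
      · exact KrausOesterle1992.lFunction_apply_prime_eq_one_or_eq_neg_one_of_mult W ℓ hmul
    refine not_dvd_c_of_tameTwist57_at hp57 W ?_ D hopt (hPT W (isIsogenous_self W)) hadd hirr hpN ha
    intro M _ g hg hp5' hng hnm hirr' m _ hcop hcl χ hχ hχ1 hord' ϖ r
    refine katoNeronBody_of_sl2NeronValuesBar_of_isDeRhamAt hT₂ cupLogInjective_and_hasDualExp_of_isDeRham_holds hP1 W p
      ?_ g hg hp5' hng hnm hirr' m hcop hcl χ hχ hχ1 hord' ϖ r
    intro v hpv _ _ _ hp' _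
    exact DeRhamAtFiveSeven.isDeRham_adicCompletion_rat_fiveSeven W hp57 hadd hirr hK v hpv hp'
  · -- on it: the auxiliary unit twist at `W` itself
    push Not at hPT
    obtain ⟨W', hE', hM', hisoW', P, hP, hP0⟩ := hPT
    obtain ⟨q, hq, hq2, hqp, hqN', hnsq, hu⟩ := AuxPrime.transferWitness p W hp57 hadd hirr
    haveI : Fact q.Prime := ⟨hq⟩
    have hqsq : ¬ q ^ 2 ∣ W.conductorNorm ℤ := fun h ↦ hqN' ((dvd_pow_self q two_ne_zero).trans h)
    have hgm : W.HasGoodReductionAtPrime q ∨ W.HasMultiplicativeReductionAtPrime q :=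
      hasGoodReductionAtPrime_or_hasMultiplicativeReductionAtPrime_of_not_sq_dvd_conductorNorm (V := W) hqsq
    obtain ⟨Vχ, hEχ, hMχ, v, hv⟩ := exists_minimal_twist_pStar q W
    haveI := hEχ
    haveI := hMχ
    haveI : NeZero (Vχ.conductorNorm ℤ) := ⟨(Vχ.conductorNorm_pos_holds).ne'⟩
    have hv' : v • W.quadraticTwist (((-1 : ℤ) ^ (q / 2) * q : ℤ) : ℚ) = Vχ := by
      rw [(pStar_intCast q).1]; exact hv
    obtain ⟨s, hs2⟩ := IsAlgClosed.exists_pow_nat_eq ((((-1 : ℤ) ^ (q / 2) * q : ℤ)) : ℂ) two_pos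
    have hPTχ := TorsTwist.torsTwist57_input p q W hp57 hadd hirr hqp hnsq ⟨W', hE', hM', P, hisoW', hP0, hP⟩ Vχ v hv'
    have hL : ∀ (N' : ℕ) [NeZero N'] (g : CuspForm (Gamma0 N') 2), IsNewformOf Vχ g →
        ∀ z ∈ periodLattice D.f, ∃ w ∈ periodLattice g, ∃ y ∈ periodLattice D.f, z = s * w + (p : ℂ) * y :=
      fun N' _ g hg ↦ LTwistTransfer.lTwist_of_transfer W D hq2 hqp hqN' hu Vχ v hv' s hs2 g hg
    exact not_dvd_optimal_c_of_expStarTower_of_sl2NeronValuesBar_of_unitTwist hT₂ hP1 hnf hp57 W hadd hirr hK W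
      (isIsogenous_self W) D hopt hq2 hqp hgm Vχ v hv' hPTχ s hs2 hL

/-- ★★★ **The same GRANTED Kato's explicit reciprocity law [REC-tower], P1-bar and modularity** (hT₂ :=
`exists_smul_range_expStarCoord_tower_iff_trace_log_of_reciprocityLaw hrec`, p700964).
[cite: Kato1993LNM1553, Ch. II Thm. 1.4.1 (4), Lemma 1.4.3–1.4.5] [cite: Kato2004Asterisque, (8.1.3) (p. 180), Thm. 9.7 (p. 189)] -/
theorem not_dvd_optimal_c_fiveSeven_of_reciprocityLaw_of_sl2NeronValuesBar
    (hrec : tatePairingPoint_eq_trace_expStar_log_tower) (hP1 : exists_member_sl2ZetaElement_neron_values_bar)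
    (hnf : exists_isNewformOf)
    (W : WeierstrassCurve ℚ) [W.IsElliptic] [W.IsGloballyMinimal] {N : ℕ} [NeZero N]
    (D : ModularParametrizationData W N) (hp57 : p = 5 ∨ p = 7) (hadd : Addv W p) (hirr : Irr W p)
    (hK : ∀ (v : HeightOneSpectrum ℤ) (n : ℕ), natGenerator v = p → W.kodairaSymbolAt v ≠ KodairaSymbol.Istar n)
    (hopt : ∀ z ∈ D.L.lattice, ∃ w ∈ periodLattice D.f, z = D.c * w) :
    ¬ (p : ℤ) ∣ D.c :=
  not_dvd_optimal_c_fiveSeven_of_expStarTower_of_sl2NeronValuesBar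
    (exists_smul_range_expStarCoord_tower_iff_trace_log_of_reciprocityLaw hrec) hP1 hnf W D hp57 hadd hirr hK hopt

/-! ### §1b The (G)-ordinary optimal Manin unit at `p > 7` -/

/-- ★★★ **Manin's `p`-part at every lattice-optimal datum of every `W/ℚ` additive at `p > 7` with `E[p]` irreducible and SOME isogenous
curve (G)-ordinary at `p`, GRANTED hT₂, P1-bar and modularity**: the `p > 7` tame-twist lever `not_dvd_c_of_tameTwistL_at` at `W`
through the per-class socket `katoNeronBody_of_sl2NeronValuesBar_of_isDeRhamAt`, its de Rham input being the tree theorem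
`isDeRham_restrictedRationalTateRep_adicCompletion_rat_of_typeGOrd` at the (G)-ordinary member, moved along the isogeny
(`isDeRham_restrictedRationalTateRep_of_isIsogenous`). CONDITIONAL on the cite-only hT₂ / P1-bar.
[cite: Kato2004Asterisque, Thm. 6.6 (1) (p. 163), (8.1.3) (p. 180), Thm. 9.7 (p. 189)] [cite: Kato1993LNM1553, Ch. II Prop. 1.2.3 and Ex. 1.3.5]
[cite: DokchitserDokchitser2015LocalInvariants, Thm. 3.2] [cite: KrausOesterle1992, Prop. 1] -/
theorem not_dvd_optimal_c_of_typeGOrd_member_of_expStarTower_of_sl2NeronValuesBar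
    (hT₂ : exists_smul_range_expStarCoord_tower_iff_trace_log) (hP1 : exists_member_sl2ZetaElement_neron_values_bar)
    (hnf : exists_isNewformOf)
    (W : WeierstrassCurve ℚ) [W.IsElliptic] [W.IsGloballyMinimal] {N : ℕ} [NeZero N]
    (D : ModularParametrizationData W N) (hp7 : 7 < p) (hadd : Addv W p) (hirr : Irr W p)
    (hG : ∃ (W' : WeierstrassCurve ℚ) (_ : W'.IsElliptic) (_ : W'.IsGloballyMinimal), IsIsogenous W W' ∧ TypeGOrd W' p)
    (hopt : ∀ z ∈ D.L.lattice, ∃ w ∈ periodLattice D.f, z = D.c * w) :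
    ¬ (p : ℤ) ∣ D.c := by
  have hN : N = W.conductorNorm ℤ := IsNewformOf.level_eq_conductorNorm_of_exists_isNewformOf hnf D.isNewformOf
  subst hN
  have hpN : p ^ 2 ∣ W.conductorNorm ℤ := sq_dvd_conductorNorm_of_not_good_of_not_mult hadd
  have ha : ∀ ℓ ∈ (W.conductorNorm ℤ).primeFactors, ¬ ℓ ^ 2 ∣ W.conductorNorm ℤ →
      W.LFunction ℓ = 1 ∨ W.LFunction ℓ = -1 := by
    intro ℓ hℓ hℓ2
    haveI : Fact ℓ.Prime := ⟨Nat.prime_of_mem_primeFactors hℓ⟩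
    rcases hasGoodReductionAtPrime_or_hasMultiplicativeReductionAtPrime_of_not_sq_dvd_conductorNorm (V := W) hℓ2
      with hg | hmul
    · exact absurd (Nat.dvd_of_mem_primeFactors hℓ) (not_dvd_conductorNorm_of_hasGoodReductionAtPrime W hg)
    · exact KrausOesterle1992.lFunction_apply_prime_eq_one_or_eq_neg_one_of_mult W ℓ hmul
  obtain ⟨W', hE', hM', hiso', hG'⟩ := hG
  haveI := hE'
  refine not_dvd_c_of_tameTwistL_at W ?_ D hopt hp7 hadd hirr hpN ha
  intro M _ g hg hp7' hng hnm hirr' m _ hcop χ hχ hχ1 hord' ϖ r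
  refine katoNeronBody_of_sl2NeronValuesBar_of_isDeRhamAt hT₂ cupLogInjective_and_hasDualExp_of_isDeRham_holds hP1 W p
    ?_ g hg (by omega) hng hnm hirr' m hcop (Or.inl hp7') χ hχ hχ1 hord' ϖ r
  intro v hpv _ _ _ hp' _
  exact isDeRham_restrictedRationalTateRep_of_isIsogenous hp' hiso'.symm_of_charZero
    (isDeRham_restrictedRationalTateRep_adicCompletion_rat_of_typeGOrd W' p hG' v hpv hp')

/-! ### §2 The route's items by name -/

/-- `ord_p Δ_min ≤ 4` at an additive `p ≥ 5` excludes every `Iₙ*` fibre at the places of generator `p`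
(`TeichmullerTwistDescent.forall_ne_Istar_of_padicValInt_le_four` in the binder shape of the route decls). [cite: SilvermanATAEC1994, IV Table 4.1] -/
theorem forall_ne_Istar_of_padicValInt_le_four (W : WeierstrassCurve ℚ) [W.IsElliptic] [W.IsGloballyMinimal] (hp5 : 5 ≤ p)
    (hadd : Addv W p) (h4 : padicValInt p W.minimalDiscriminantInt ≤ 4) :
    ∀ (v : HeightOneSpectrum ℤ) (n : ℕ), natGenerator v = p → W.kodairaSymbolAt v ≠ KodairaSymbol.Istar n :=
  (TeichmullerTwistDescent.forall_ne_Istar_iff_placeOf W p).2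
    (TeichmullerTwistDescent.forall_ne_Istar_of_padicValInt_le_four W p hp5 hadd h4)

/-- **CORNER `KummerCornerTorsionOptimalManinUnit` (stmt-BirchSwinnertonDyer-23883; this route's copy) GRANTED ONLY modularity, hT₂ and
P1-bar** — the (G)-ordinary and torsion binders are not used. CONDITIONAL; the item stays OPEN; BSD is not proved by this.
[cite: Kato2004Asterisque, (8.1.3) (p. 180), Thm. 9.7 (p. 189)] [cite: KostersPannekoek2017, Cor. 2] -/
theorem kummerCornerTorsionOptimalManinUnit_of_expStarTower_of_sl2NeronValuesBar (hnf : exists_isNewformOf)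
    (hT₂ : exists_smul_range_expStarCoord_tower_iff_trace_log) (hP1 : exists_member_sl2ZetaElement_neron_values_bar) :
    KummerCornerTorsionOptimalManinUnit := by
  intro W _ _ p _ _ D hcell hadd hirr _ _ hopt
  have hp57 : p = 5 ∨ p = 7 := by rcases hcell with ⟨h, -⟩ | ⟨h, -⟩ <;> simp [h]
  have h4 : padicValInt p W.minimalDiscriminantInt ≤ 4 := by rcases hcell with ⟨-, h⟩ | ⟨-, h⟩ <;> omega
  exact not_dvd_optimal_c_fiveSeven_of_expStarTower_of_sl2NeronValuesBar hT₂ hP1 hnf W D hp57 hadd hirr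
    (forall_ne_Istar_of_padicValInt_le_four W (by omega) hadd h4) hopt

/-- **CORNER (23883) GRANTED ONLY modularity, [REC-tower] and P1-bar.** CONDITIONAL; the item stays OPEN.
[cite: Kato1993LNM1553, Ch. II Thm. 1.4.1 (4)] [cite: Kato2004Asterisque, (8.1.3) (p. 180), Thm. 9.7 (p. 189)] -/
theorem kummerCornerTorsionOptimalManinUnit_of_reciprocityLaw_of_sl2NeronValuesBar (hnf : exists_isNewformOf)
    (hrec : tatePairingPoint_eq_trace_expStar_log_tower) (hP1 : exists_member_sl2ZetaElement_neron_values_bar) :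
    KummerCornerTorsionOptimalManinUnit :=
  kummerCornerTorsionOptimalManinUnit_of_expStarTower_of_sl2NeronValuesBar hnf
    (exists_smul_range_expStarCoord_tower_iff_trace_log_of_reciprocityLaw hrec) hP1

/-- **LOW `SupersingularTorsionOptimalManinUnitFive` (stmt-BirchSwinnertonDyer-23884; this route's copy) GRANTED ONLY modularity, hT₂
and P1-bar** — the supersingularity and torsion binders are not used. CONDITIONAL; the item stays OPEN; BSD is not proved by this.
[cite: Kato2004Asterisque, (8.1.3) (p. 180), Thm. 9.7 (p. 189)] [cite: KostersPannekoek2017, Cor. 2] -/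
theorem supersingularTorsionOptimalManinUnitFive_of_expStarTower_of_sl2NeronValuesBar (hnf : exists_isNewformOf)
    (hT₂ : exists_smul_range_expStarCoord_tower_iff_trace_log) (hP1 : exists_member_sl2ZetaElement_neron_values_bar) :
    SupersingularTorsionOptimalManinUnitFive := by
  intro W _ _ p _ _ D hcell hadd hirr _ _ hopt
  have hp57 : p = 5 ∨ p = 7 := by rcases hcell with ⟨h, -⟩ | ⟨h, -⟩ <;> simp [h]
  have h4 : padicValInt p W.minimalDiscriminantInt ≤ 4 := by
    rcases hcell with ⟨-, h | h⟩ | ⟨-, h⟩ <;> omega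
  exact not_dvd_optimal_c_fiveSeven_of_expStarTower_of_sl2NeronValuesBar hT₂ hP1 hnf W D hp57 hadd hirr
    (forall_ne_Istar_of_padicValInt_le_four W (by omega) hadd h4) hopt

/-- **LOW (23884) GRANTED ONLY modularity, [REC-tower] and P1-bar.** CONDITIONAL; the item stays OPEN.
[cite: Kato1993LNM1553, Ch. II Thm. 1.4.1 (4)] [cite: Kato2004Asterisque, (8.1.3) (p. 180), Thm. 9.7 (p. 189)] -/
theorem supersingularTorsionOptimalManinUnitFive_of_reciprocityLaw_of_sl2NeronValuesBar (hnf : exists_isNewformOf)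
    (hrec : tatePairingPoint_eq_trace_expStar_log_tower) (hP1 : exists_member_sl2ZetaElement_neron_values_bar) :
    SupersingularTorsionOptimalManinUnitFive :=
  supersingularTorsionOptimalManinUnitFive_of_expStarTower_of_sl2NeronValuesBar hnf
    (exists_smul_range_expStarCoord_tower_iff_trace_log_of_reciprocityLaw hrec) hP1

/-- **K★ `StarredOptimalManinUnitFiveSeven` (stmt-BirchSwinnertonDyer-22226) as the starred sub-case of §1, GRANTED ONLY modularity,
[REC-tower] and P1-bar** (the line's closer `starredOptimalManinUnitFiveSeven_of_reciprocityLaw_of_sl2NeronValuesBar`, p701880, does not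
need modularity: on the starred cells `W(ℚ_p)[p] = 0` and no twist is taken; this variant is recorded for uniformity only).
CONDITIONAL; the item stays OPEN. [cite: Kato1993LNM1553, Ch. II Thm. 1.4.1 (4)] [cite: Kato2004Asterisque, (8.1.3) (p. 180), Thm. 9.7 (p. 189)]
[cite: EdixhovenManin1991, Thm. 3] -/
theorem starredOptimalManinUnitFiveSeven_of_reciprocityLaw_of_sl2NeronValuesBar_of_modularity (hnf : exists_isNewformOf)
    (hrec : tatePairingPoint_eq_trace_expStar_log_tower) (hP1 : exists_member_sl2ZetaElement_neron_values_bar) :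
    StarredOptimalManinUnitFiveSeven := by
  intro W _ _ p _ _ D hp57 hadd hirr hK _ hopt
  exact not_dvd_optimal_c_fiveSeven_of_reciprocityLaw_of_sl2NeronValuesBar hrec hP1 hnf W D hp57 hadd hirr hK hopt

/-! ### §3 The rung of the route, with `KatoNeronAndCremonaFacts` replaced by {[REC-tower], P1-bar} -/

/-- ★★ **The rung `WAllExclAdditiveFiveLeRankOne` (W-ALL/2.p>=5.r1) GRANTED [REC-tower], P1-bar, the three AKR-shared open cruxes and the
two published-input bundles** — through the landed `EdixhovenFibreFiveSevenAssembly.assembly_proof` (22231) fed with K★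
(`starredOptimalManinUnitFiveSeven_of_reciprocityLaw_of_sl2NeronValuesBar`, p701880), TDS57 (`twistDegreeStepFiveSeven_of_reciprocityLaw_of_sl2NeronValuesBar`,
this seat), TDS11 (`twistDegreeStepOrdinary_of_reciprocityLaw_of_sl2NeronValuesBar`, p704378) and the closed glue G57
(`memberManinUnitFiveSevenGlue_proof`). Neither `KatoNeronAndCremonaFacts` (F″, Cremona's range) nor KP57 is a hypothesis. CONDITIONAL
(two cite-only printed facts + three OPEN cruxes + two hypothesis-only bundles); no item is closed by this; BSD is not proved and no
W-ALL class theorem is proved by this. [cite: Kato1993LNM1553, Ch. II Thm. 1.4.1 (4)] [cite: Kato2004Asterisque, Thm. 6.6 (1) (p. 163), (8.1.3) (p. 180), Thm. 9.7 (p. 189)]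
[cite: WZhang2014, Thm. 1.1] -/
theorem wAllExclAdditiveFiveLeRankOne_of_akr_of_reciprocityLaw_of_sl2NeronValuesBar
    (hrec : tatePairingPoint_eq_trace_expStar_log_tower) (hP1 : exists_member_sl2ZetaElement_neron_values_bar)
    (h₁ : KolyvaginPrimitiveAdditive) (h₀ : RankZeroAdditive) (hoff : OffSharpRankOneAdditive)
    (hP : PublishedInputsAdditiveKoly) (hF : PublishedManinFacts) :
    Summit.BirchSwinnertonDyer.WAllExclAdditiveFiveLeRankOne :=
  EdixhovenFibreFiveSevenAssembly.assembly_proof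
    (StarredOptimalManinUnitFiveSevenOfReciprocityLaw.starredOptimalManinUnitFiveSeven_of_reciprocityLaw_of_sl2NeronValuesBar hrec hP1)
    (twistDegreeStepFiveSeven_of_reciprocityLaw_of_sl2NeronValuesBar hrec hP1)
    (TwistDegreeStepOrdinaryOfReciprocityLaw.twistDegreeStepOrdinary_of_reciprocityLaw_of_sl2NeronValuesBar hrec hP1)
    MemberManinUnitFiveSevenGlue.memberManinUnitFiveSevenGlue_proof h₁ h₀ hoff hP hF

end Summit.BirchSwinnertonDyer.BirchSwinnertonDyer.Theorems.OptimalManinUnitFiveSevenOfReciprocityLaw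

end
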